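import Summits.BirchSwinnertonDyer.BirchSwinnertonDyer.Theorems.PrintCf2RubinValueTwoRowTwoTwistedKummerClass
import Mathlib.Tactic.Group
import HarnessLib

/-!
# M-LINE-PIN / (α3) ROW 2, FILE 3d: the CONJUGATION LAW of the twisted Kummer classes — `γ · κ(β) = κ(γβ)` when `θ(γ) = 1`

Cell `bsd-print-cf2`, WIDTH seat `bsd-line-cf2-p1-w6` g8 (prover-bsd-line-cf2-p1-w6-g8-0); (α3) ROW 2 on the DECIDING child stmt-BirchSwinnertonDyer-24721
(memo `HOME/bsd-line-cf2-p1-w6/ROW2-SPEC-w6g8.md`; hypothesis `hkum_i` of `RowTwo.proj_lift_X_smul_sub_mem`); `--supports` that item (helper,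
Theses-free). HONEST FRAMING: cohomological bookkeeping; nothing about BSD. THEOREMS ONLY.

* `isTwistedKummerClass_levelConj` — for `U ⊴ Γ_K` and `γ` with `θ γ = 1` (the crux's generators `γ_i⁻¹`, `θ(γ_i) = 1` in the frame):
  `levelConj … k 1 γ` sends a class of `β` to a class of `γ•β` (JLK §3.3 (5) `κ(g u) ⊗ t = θ(g)⁻¹ · g⋆(κ(u) ⊗ t)` with `θ(g) = 1`).

References: J. Johnson-Leung, G. Kings (2011) §3.3 (5)–(6); J.-P. Serre, *Local Fields* VII §5.
-/

noncomputable section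

-- the summit namespace `Summit.BirchSwinnertonDyer.BirchSwinnertonDyer` repeats the problem name by design (D-0017)
set_option linter.dupNamespace false
set_option autoImplicit false

open scoped NumberField
open Field IsDedekindDomain
open Literature.NumberTheory.GaloisRepresentations Literature.NumberTheory.GaloisRepresentations.DiscreteGaloisModule
open Literature.NumberTheory.ComplexMultiplication.EllipticUnits.JohnsonLeungKings2011
open Literature.NumberTheory.EllipticCurves (subgroupConj subgroupConj_apply_coe)

namespace Summit.BirchSwinnertonDyer.BirchSwinnertonDyer.Theorems.PrintCf2.RowTwo

variable {K : Type} [Field K] [NumberField K] (p : ℕ) [Fact p.Prime] (S : Set (HeightOneSpectrum (𝓞 K)))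
  (θ : absoluteGaloisGroup K →ₜ* ℤ_[p]ˣ) (U : Subgroup (absoluteGaloisGroup K)) [U.Normal] (k : ℕ)

omit [NumberField K] in
/-- **Conjugation law**: for `θ γ = 1`, `levelConj … k 1 γ` sends a twisted Kummer class of `β` at level `U ⊴ Γ_K` to a twisted Kummer class of `γ•β`
(`(γ·φ)(σ) = γ ⋆ φ(γ⁻¹σγ) = γ((γ⁻¹σγ)β/β) = σ(γβ)/(γβ)` since the twist of `γ` is trivial). [cite: JohnsonLeungKings2011, §3.3 (5) (arXiv p0010:L61–70)] -/
theorem isTwistedKummerClass_levelConj {β : (AlgebraicClosure K)ˣ} {c : levelCoh p S θ U k 1}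
    (hc : IsTwistedKummerClass p θ S U k β c) (γ : absoluteGaloisGroup K) (hγ : θ γ = 1) :
    IsTwistedKummerClass p θ S U k (γ • β) (levelConj p S θ U k 1 γ c) := by
  haveI hN : (imGS S U).Normal := Subgroup.Normal.map inferInstance _ (toUnramifiedQuot_surjective K S)
  obtain ⟨φ₀, rfl, hφ⟩ := hc
  let X := (coeffGS p S θ k).toTopRep
  let g : GaloisGroupUnramifiedOutside K S := toUnramifiedQuot K S γ
  let φ : contOneCocycles (subgroupRep X (imGS S U)) := φ₀
  let ψ : contOneCocycles (subgroupRep X (imGS S U)) :=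
    contOneCocycles.pullback (subgroupConj (imGS S U) g) (conjRepHom X (imGS S U) g) φ
  refine ⟨ψ, ?_, fun σ hσ ↦ ?_⟩
  · rw [levelConj_apply]
    exact (conjMap_oneCocycleClass X (imGS S U) g φ).symm
  · have hσ' : γ⁻¹ * σ * γ ∈ U := by
      have h := Subgroup.Normal.conj_mem inferInstance σ hσ γ⁻¹
      rwa [inv_inv] at h
    have hx : subgroupConj (imGS S U) g ⟨toUnramifiedQuot K S σ, Subgroup.mem_map_of_mem _ hσ⟩ =
        (⟨toUnramifiedQuot K S (γ⁻¹ * σ * γ), Subgroup.mem_map_of_mem _ hσ'⟩ : imGS S U) := by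
      apply Subtype.ext
      change g⁻¹ * toUnramifiedQuot K S σ * g = toUnramifiedQuot K S (γ⁻¹ * σ * γ)
      rw [map_mul, map_mul, map_inv]
    change muVal K (p ^ k) (muTwist p θ k γ
      ((φ.1 (subgroupConj (imGS S U) g ⟨toUnramifiedQuot K S σ, Subgroup.mem_map_of_mem _ hσ⟩) :
          Representation.invariants ((muTwist p θ k).toRepresentation.comp (ramificationSubgroup K S).subtype)) :
        MuCarrier K (p ^ k))) = _
    rw [hx, muTwist_apply_of_apply_eq_one p θ k hγ, muVal_apply, hφ _ hσ', smul_div', ← mul_smul, ← mul_smul,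
      show γ * (γ⁻¹ * σ * γ) = σ * γ by group, mul_smul]

end Summit.BirchSwinnertonDyer.BirchSwinnertonDyer.Theorems.PrintCf2.RowTwo

end
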